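import Literature.AnabelianGeometry.SemiGraphs.ProSigmaCompletionWreath
import HarnessLib

/-!
# Disjointness of closed procyclic subgroups from one finite quotient per level; the two-cusp case

[SemiAnbd] Example 2.10 (p. 31) / [AbsAnab] Lemma 1.3.7: in the pro-`Σ` completion `ι : Γ_{g,r} → P` of
a hyperbolic punctured surface group the closed cusp inertia subgroups `I_i = closure ι⟨c_i⟩` of DISTINCT
cusps satisfy `I_i ∩ x I_j x⁻¹ = 1` — part of abc-iut-L3-t11's named fact `ProSigmaCuspInertiaMalnormal`
(`SurfaceTypeEstranged.lean`, input of "totally estranged") [cite: MochizukiSemiAnbd2006, Ex. 2.10 p.31].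
abc-iut-L5-t9 proved it for `r ≥ 3` by cusp characters (`ProSigmaCuspInertiaDisjoint.lean`); for `r = 2`
no character separates the two cusps (`c₁ ≡ c₂⁻¹` in homology).

This file isolates the general principle behind the character argument and applies it to `r = 2` with a
NON-ABELIAN finite quotient:

* `closure_zpowers_inf_conj_eq_bot_of_quotients` — for `c, c' ∈ Γ` and a pro-`Σ` completion
  `ι : Γ → P` (`P` profinite): if for every `Σ`-integer `n` some homomorphism `φ : Γ → G` to a finite group
  of `Σ`-integer order KILLS `c` and gives `c'` an order divisible by `n`, then
  `closure ι⟨c⟩ ∩ x · closure ι⟨c'⟩ · x⁻¹ = 1` for every `x ∈ P` (no centrality needed: a conjugate of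
  `φ(c')^τ` is trivial iff `φ(c')^τ` is);
* `PuncturedSurfaceGroup.exists_hom_wreath_two_cusps` — for `g ≥ 1` and every `n ≥ 1` a homomorphism
  `Γ_{g,2} → C_n ≀ C_n` with `c₁ ↦ 1` and `c₂ ↦ [X, Y]⁻¹` of order divisible by `n`
  (`a₁ ↦ X = (1, t)`, `b₁ ↦ Y = (δ_1, 1)`, all other generators `↦ 1`; the relator
  `[a₁,b₁]⋯[a_g,b_g] c₁ c₂` goes to `[X,Y]·[X,Y]⁻¹ = 1`);
* `cuspInertia_closure_inf_conj_eq_bot_two` — **the `r = 2` clause**: for hyperbolic `(g, 2)` (i.e.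
  `g ≥ 1`), `i ≠ j` and every `x`, `I_i ∩ x I_j x⁻¹ = 1`.

Theorems only; classical (pro)finite group theory; no side is taken on [IUTchIII] Cor. 3.12.
-/

/-! ### A two-generator finite `Σ`-group with a commutator of large order: `C_n ≀ C_n` -/

namespace Literature.AnabelianGeometry.SemiGraphs.SemiGraphOfAnabelioids.IsProSigmaCompletion

open Multiplicative

/-- Powers of an element of the base of a wreath product are computed pointwise.
[cite: MochizukiSemiAnbd2006, Ex. 2.10 p.31] -/
theorem wreath_pow_of_right_eq_one {D Q : Type*} [Group D] [Group Q] (w : D ≀ᵣ Q) (hw : w.right = 1)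
    (k : ℕ) : w ^ k = ⟨w.left ^ k, 1⟩ := by
  induction k with
  | zero => ext <;> simp
  | succ k ih =>
    rw [pow_succ, ih]
    ext q
    · simp [pow_succ]
    · simp [hw]

/-- **The commutator `[X, Y]` in `C_n ≀ C_n`**, `X = (1, t)`, `Y = (δ_1, 1)` with `t = 1 ∈ ℤ/n` the
generator of the top group and `δ_1` the indicator of the identity in the base: every power
`[X,Y]^k = 1` has `n ∣ k` (evaluate the base coordinate at the identity).
[cite: MochizukiSemiAnbd2006, Ex. 2.10 p.31] -/
theorem wreath_commutator_pow_eq_one_imp {n : ℕ} [NeZero n] (k : ℕ)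
    (hk : ((RegularWreathProduct.inl (ofAdd (1 : ZMod n)) : Multiplicative (ZMod n) ≀ᵣ
        Multiplicative (ZMod n)) *
        ⟨fun q => if q = 1 then ofAdd (1 : ZMod n) else 1, 1⟩ *
        (RegularWreathProduct.inl (ofAdd (1 : ZMod n)))⁻¹ *
        (⟨fun q => if q = 1 then ofAdd (1 : ZMod n) else 1, 1⟩ : Multiplicative (ZMod n) ≀ᵣ
          Multiplicative (ZMod n))⁻¹) ^ k = 1) :
    n ∣ k := by
  classical
  set t : Multiplicative (ZMod n) := ofAdd 1 with ht
  set δ : Multiplicative (ZMod n) → Multiplicative (ZMod n) := fun q => if q = 1 then ofAdd 1 else 1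
    with hδ
  set z : Multiplicative (ZMod n) ≀ᵣ Multiplicative (ZMod n) :=
    RegularWreathProduct.inl t * ⟨δ, 1⟩ * (RegularWreathProduct.inl t)⁻¹ * (⟨δ, 1⟩)⁻¹ with hzdef
  have hz : z = ⟨fun q => δ (t⁻¹ * q) * (δ q)⁻¹, 1⟩ := by
    rw [hzdef]
    ext q
    · simp [RegularWreathProduct.mul_def]
    · simp
  change z ^ k = 1 at hk
  rw [hz, wreath_pow_of_right_eq_one _ rfl] at hk
  have h1 := congrArg (fun w : Multiplicative (ZMod n) ≀ᵣ Multiplicative (ZMod n) => toAdd (w.left 1))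
    hk
  simp only [Pi.pow_apply, mul_one, RegularWreathProduct.one_left, Pi.one_apply, toAdd_one] at h1
  -- at `q = 1`: `δ(t⁻¹) = 1` unless `n = 1`, and `δ 1 = ofAdd 1`
  by_cases hn1 : n = 1
  · subst hn1; exact one_dvd k
  have ht1 : t⁻¹ ≠ 1 := by
    rw [Ne, inv_eq_one, ht, ofAdd_eq_one]
    exact fun h => hn1 (ZMod.one_eq_zero_iff.mp h)
  have : δ t⁻¹ = 1 := by simp [hδ, ht1]
  rw [this] at h1
  simp only [hδ, if_pos rfl, one_mul, inv_pow, toAdd_inv, toAdd_pow, toAdd_ofAdd, nsmul_eq_mul,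
    mul_one, neg_eq_zero] at h1
  exact (ZMod.natCast_eq_zero_iff k n).mp h1

end Literature.AnabelianGeometry.SemiGraphs.SemiGraphOfAnabelioids.IsProSigmaCompletion

/-! ### The quotient of `Γ_{g,2}` separating the two cusps -/

namespace Literature.GroupTheory.CombinatorialGroupTheory.PuncturedSurfaceGroup

open Multiplicative
open Literature.AnabelianGeometry.SemiGraphs.SemiGraphOfAnabelioids.IsProSigmaCompletion

variable {g : ℕ}

/-- **A finite quotient of `Γ_{g,2}` (`g ≥ 1`) killing `c₁` in which `c₂` has order divisible by `n`**:
`a₁ ↦ X = (1, t)`, `b₁ ↦ Y = (δ_1, 1)` in `C_n ≀ C_n`, all other `a_i, b_i ↦ 1`, `c₁ ↦ 1`,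
`c₂ ↦ [X,Y]⁻¹`; the relator `[a₁,b₁]⋯[a_g,b_g]·c₁c₂ ↦ [X,Y]·1·[X,Y]⁻¹ = 1`.
[cite: MochizukiSemiAnbd2006, Ex. 2.10 p.31] -/
theorem exists_hom_wreath_two_cusps (hg : 1 ≤ g) (n : ℕ) [NeZero n] :
    ∃ φ : PuncturedSurfaceGroup g 2 →* Multiplicative (ZMod n) ≀ᵣ Multiplicative (ZMod n),
      φ (c 0) = 1 ∧ ∀ k : ℕ, φ (c 1) ^ k = 1 → n ∣ k := by
  classical
  obtain ⟨g', rfl⟩ : ∃ g', g = g' + 1 := ⟨g - 1, by omega⟩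
  set X : Multiplicative (ZMod n) ≀ᵣ Multiplicative (ZMod n) :=
    RegularWreathProduct.inl (ofAdd (1 : ZMod n)) with hX
  set Y : Multiplicative (ZMod n) ≀ᵣ Multiplicative (ZMod n) :=
    ⟨fun q => if q = 1 then ofAdd (1 : ZMod n) else 1, 1⟩ with hY
  set z := X * Y * X⁻¹ * Y⁻¹ with hz
  let f : puncturedSurfaceGen (g' + 1) 2 → Multiplicative (ZMod n) ≀ᵣ Multiplicative (ZMod n) :=
    fun s => match s with
      | Sum.inl (i, false) => if i = 0 then X else 1
      | Sum.inl (i, true) => if i = 0 then Y else 1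
      | Sum.inr j => if j = 0 then 1 else z⁻¹
  have hfa0 : f (Sum.inl (0, false)) = X := by simp [f]
  have hfb0 : f (Sum.inl (0, true)) = Y := by simp [f]
  have hfas : ∀ i : Fin g', f (Sum.inl (Fin.succ i, false)) = 1 := fun i => by
    simp [f, Fin.succ_ne_zero]
  have hfbs : ∀ i : Fin g', f (Sum.inl (Fin.succ i, true)) = 1 := fun i => by
    simp [f, Fin.succ_ne_zero]
  have hfc0 : f (Sum.inr 0) = 1 := by simp [f]
  have hfc1 : f (Sum.inr 1) = z⁻¹ := by simp [f]
  have hrel : ∀ v ∈ ({relator (g' + 1) 2} : Set (FreeGroup (puncturedSurfaceGen (g' + 1) 2))),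
      FreeGroup.lift f v = 1 := by
    intro v hv
    rw [Set.mem_singleton_iff] at hv
    subst hv
    simp only [relator, map_mul, map_list_prod, List.map_map, Function.comp_def, map_inv, genA, genB,
      genC, FreeGroup.lift_apply_of, List.finRange_succ, List.map_cons, List.prod_cons, hfa0, hfb0,
      hfas, hfbs, hfc0]
    have h1 : ((List.finRange g').map fun i : Fin g' =>
        (1 : Multiplicative (ZMod n) ≀ᵣ Multiplicative (ZMod n)) * 1 * 1⁻¹ * 1⁻¹).prod = 1 :=
      List.prod_eq_one fun y hy => by
        obtain ⟨i, -, rfl⟩ := List.mem_map.mp hy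
        simp
    rw [h1]
    simp [hfc1, hz]
  refine ⟨PresentedGroup.toGroup hrel, ?_, fun k hk => ?_⟩
  · rw [c, PresentedGroup.toGroup.of]
    exact hfc0
  · rw [c, PresentedGroup.toGroup.of, hfc1, inv_pow, inv_eq_one] at hk
    exact wreath_commutator_pow_eq_one_imp k hk

end Literature.GroupTheory.CombinatorialGroupTheory.PuncturedSurfaceGroup

/-! ### Disjointness from one finite quotient per level -/

namespace Literature.AnabelianGeometry.SemiGraphs.SemiGraphOfAnabelioids.IsProSigmaCompletion

open Literature.AnabelianGeometry.Anabelioids Literature.GroupTheory.CombinatorialGroupTheory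
open Multiplicative
open scoped Pointwise

universe v

/-- Disjointness up to conjugacy is symmetric in the two subgroups. [cite: MochizukiSemiAnbd2006, Ex. 2.10 p.31] -/
theorem inf_conj_eq_bot_symm {H : Type*} [Group H] {A B : Subgroup H}
    (h : ∀ x : H, A ⊓ ConjAct.toConjAct x • B = ⊥) (x : H) : B ⊓ ConjAct.toConjAct x • A = ⊥ := by
  rw [eq_bot_iff]
  rintro z ⟨hzB, hzA⟩
  obtain ⟨a, ha, hxa⟩ := (Subgroup.mem_smul_pointwise_iff_exists _ _ _).mp hzA
  rw [ConjAct.toConjAct_smul] at hxa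
  have haB : a ∈ ConjAct.toConjAct x⁻¹ • B := by
    refine (Subgroup.mem_smul_pointwise_iff_exists _ _ _).mpr ⟨z, hzB, ?_⟩
    rw [ConjAct.toConjAct_smul, ← hxa]
    group
  have ha1 : a ∈ A ⊓ ConjAct.toConjAct x⁻¹ • B := ⟨ha, haB⟩
  rw [h x⁻¹, Subgroup.mem_bot] at ha1
  rw [Subgroup.mem_bot, ← hxa, ha1, mul_one, mul_inv_cancel]

variable {Sigma : Set ℕ} {Γ : Type*} [Group Γ] {P : Type v} [Group P] [TopologicalSpace P]
  [IsTopologicalGroup P] [CompactSpace P] [TotallyDisconnectedSpace P] {ι : Γ →* P}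

/-- **Disjointness of closed procyclic subgroups from finite quotients.**  Let `ι : Γ → P` be a pro-`Σ`
completion (`P` profinite) and `c, c' ∈ Γ`.  Suppose that for every `Σ`-integer `n` there is a
homomorphism `φ : Γ → G` to a finite group of `Σ`-integer order with `φ c = 1` and such that every
power `φ(c')^k = 1` has `n ∣ k`.  Then `closure ι⟨c⟩ ∩ x · closure ι⟨c'⟩ · x⁻¹ = 1` for every `x ∈ P`.
(At an open normal `N₀ ∌ y` of index `n`, extend `φ` to `χ : P → G`; writing `y = ι(c)^σ k₁ =
x ι(c')^τ k₂ x⁻¹` modulo `N₀ ∩ Ker χ` gives `1 = χ y = χ x · φ(c')^τ · (χ x)⁻¹`, so `n ∣ τ` and `y ∈ N₀`.)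
The cusp characters of abc-iut-L5-t9 are the abelian case. [cite: MochizukiSemiAnbd2006, Ex. 2.10 p.31] -/
theorem closure_zpowers_inf_conj_eq_bot_of_quotients (hι : IsProSigmaCompletion Sigma ι) (c c' : Γ)
    (hφ : ∀ n : ℕ, IsSigmaInteger Sigma n →
      ∃ (G : Type) (_ : Group G) (_ : Finite G) (φ : Γ →* G),
        IsSigmaInteger Sigma (Nat.card G) ∧ φ c = 1 ∧ ∀ k : ℕ, φ c' ^ k = 1 → n ∣ k)
    (x : P) :
    (Subgroup.zpowers (ι c)).topologicalClosure ⊓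
      ConjAct.toConjAct x • (Subgroup.zpowers (ι c')).topologicalClosure = ⊥ := by
  classical
  rw [eq_bot_iff]
  rintro y ⟨hyI, hyJ⟩
  rw [Subgroup.mem_bot]
  by_contra hy1
  -- an open normal `N₀` missing `y`, of `Σ`-index `n`
  obtain ⟨N₀, hN₀⟩ := ProfiniteGrp.exist_openNormalSubgroup_sub_open_nhds_of_one
    (isOpen_compl_singleton (x := y)) (show (1 : P) ∈ ({y}ᶜ : Set P) from fun h => hy1 h.symm)
  have hyN₀ : y ∉ (N₀ : Subgroup P) := fun h => hN₀ h rfl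
  haveI : (N₀ : Subgroup P).Normal := N₀.isNormal'
  obtain ⟨n, hndef⟩ : ∃ n, n = (N₀ : Subgroup P).index := ⟨_, rfl⟩
  have hn : IsSigmaInteger Sigma n := hndef ▸ hι.index_open _ N₀.isNormal' N₀.isOpen'
  -- the finite quotient at this level, extended to `P`
  obtain ⟨G, _, _, φ, hG, hc, hc'⟩ := hφ n hn
  letI : TopologicalSpace G := ⊥
  haveI : DiscreteTopology G := ⟨rfl⟩
  obtain ⟨χ, hχc, hχ⟩ := hι.exists_continuous_extend_top hG φ
  -- the level `K = N₀ ∩ Ker χ`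
  have hk₁ : IsOpen (χ.ker : Set P) := (isOpen_discrete ({1} : Set _)).preimage hχc
  let Kχ : OpenNormalSubgroup P := { toSubgroup := χ.ker, isOpen' := hk₁ }
  let K : OpenNormalSubgroup P := N₀ ⊓ Kχ
  have hKle₀ : (K : Subgroup P) ≤ (N₀ : Subgroup P) := fun z hz => hz.1
  have hKleχ : (K : Subgroup P) ≤ χ.ker := fun z hz => hz.2
  haveI : (K : Subgroup P).Normal := K.isNormal'
  -- `y ∈ ι⟨c⟩ · K`
  have hyI' := topologicalClosure_le_sup_of_isOpen _ (K : Subgroup P) K.isOpen' hyI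
  rw [← SetLike.mem_coe, Subgroup.mul_normal] at hyI'
  obtain ⟨s, hs, k₁, hk₁K, hy⟩ := hyI'
  rw [SetLike.mem_coe] at hs
  obtain ⟨σ, rfl⟩ := Subgroup.mem_zpowers_iff.mp hs
  -- `y ∈ x · (ι⟨c'⟩ · K) · x⁻¹`
  obtain ⟨y', hy', hxy⟩ := (Subgroup.mem_smul_pointwise_iff_exists _ _ _).mp hyJ
  have hyJ' := topologicalClosure_le_sup_of_isOpen _ (K : Subgroup P) K.isOpen' hy'
  rw [← SetLike.mem_coe, Subgroup.mul_normal] at hyJ'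
  obtain ⟨t, ht, k₂, hk₂K, hy''⟩ := hyJ'
  rw [SetLike.mem_coe] at ht
  obtain ⟨τ, rfl⟩ := Subgroup.mem_zpowers_iff.mp ht
  -- evaluate `χ` on `y` both ways
  have e1 : χ y = 1 := by
    rw [← hy, map_mul, (hKleχ hk₁K : χ k₁ = 1), mul_one, map_zpow, hχ, hc, one_zpow]
  have e2 : χ y = χ x * φ c' ^ τ * (χ x)⁻¹ := by
    rw [← hxy, ConjAct.toConjAct_smul, map_mul, map_mul, ← hy'', map_mul,
      (hKleχ hk₂K : χ k₂ = 1), mul_one, map_zpow, hχ, map_inv]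
  have hpow : φ c' ^ τ = 1 := by
    rw [e1] at e2
    have h := e2.symm
    rwa [mul_inv_eq_one, mul_eq_left] at h
  have hdvd : (n : ℤ) ∣ τ := by
    have h1 : (orderOf (φ c') : ℤ) ∣ τ := orderOf_dvd_iff_zpow_eq_one.mpr hpow
    have h2 : n ∣ orderOf (φ c') := hc' _ (pow_orderOf_eq_one (φ c'))
    exact (Int.natCast_dvd_natCast.mpr h2).trans h1
  -- hence `ι(c')^τ ∈ N₀` and `y ∈ N₀`
  obtain ⟨d, hd⟩ := hdvd
  have hτn : ι c' ^ (n : ℤ) ∈ (N₀ : Subgroup P) := by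
    rw [zpow_natCast, hndef]
    exact Subgroup.pow_index_mem _ _
  have hτs : ι c' ^ τ ∈ (N₀ : Subgroup P) := by
    rw [hd, zpow_mul]
    exact Subgroup.zpow_mem _ hτn d
  have hy'N : y' ∈ (N₀ : Subgroup P) := hy'' ▸ (N₀ : Subgroup P).mul_mem hτs (hKle₀ hk₂K)
  apply hyN₀
  rw [← hxy, ConjAct.toConjAct_smul]
  exact (N₀.isNormal').conj_mem _ hy'N x

/-- **Distinct cusps have disjoint inertia up to conjugacy, `r = 2`.**  For a pro-`Σ` completion
`ι : Γ_{g,2} → P` (`P` profinite) of the hyperbolic type `(g, 2)` (i.e. `g ≥ 1`), distinct cusps `i ≠ j`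
and any `x ∈ P`: `closure ι⟨c_i⟩ ∩ x · closure ι⟨c_j⟩ · x⁻¹ = 1` — the `r = 2` case of the `i ≠ j`
clause of `ProSigmaCuspInertiaMalnormal`, complementing abc-iut-L5-t9's `r ≥ 3`.
[cite: MochizukiSemiAnbd2006, Ex. 2.10 p.31] -/
theorem cuspInertia_closure_inf_conj_eq_bot_two {g : ℕ} (h : PuncturedSurfaceGroup.IsHyperbolicType g 2)
    (ι : PuncturedSurfaceGroup g 2 →* P) (hι : IsProSigmaCompletion Sigma ι) {i j : Fin 2}
    (hij : i ≠ j) (x : P) :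
    ((PuncturedSurfaceGroup.cuspInertia (g := g) i).map ι).topologicalClosure ⊓
        ConjAct.toConjAct x •
          ((PuncturedSurfaceGroup.cuspInertia (g := g) j).map ι).topologicalClosure = ⊥ := by
  have hg : 1 ≤ g := by
    unfold PuncturedSurfaceGroup.IsHyperbolicType at h; omega
  -- the ordered pair `(0, 1)`
  have h01 : ∀ x : P, ((PuncturedSurfaceGroup.cuspInertia (g := g) 0).map ι).topologicalClosure ⊓
      ConjAct.toConjAct x •
        ((PuncturedSurfaceGroup.cuspInertia (g := g) 1).map ι).topologicalClosure = ⊥ := by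
    intro x
    simp only [PuncturedSurfaceGroup.cuspInertia, MonoidHom.map_zpowers]
    refine closure_zpowers_inf_conj_eq_bot_of_quotients hι _ _ (fun n hn => ?_) x
    haveI : NeZero n := ⟨hn.1.ne'⟩
    obtain ⟨φ, hφ0, hφ1⟩ := PuncturedSurfaceGroup.exists_hom_wreath_two_cusps hg n
    refine ⟨_, inferInstance, inferInstance, φ, ?_, hφ0, hφ1⟩
    have hQ : IsSigmaInteger Sigma (Nat.card (Multiplicative (ZMod n))) := by
      rw [show Nat.card (Multiplicative (ZMod n)) = n from Nat.card_zmod n]; exact hn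
    exact isSigmaInteger_card_wreath_of hn hQ
  -- the two ordered pairs of distinct cusps
  have hcases : (i = 0 ∧ j = 1) ∨ (i = 1 ∧ j = 0) := by
    rcases Fin.exists_fin_two.mp ⟨i, rfl⟩ with hi | hi <;>
      rcases Fin.exists_fin_two.mp ⟨j, rfl⟩ with hj | hj
    · exact absurd (hi.trans hj.symm) hij
    · exact Or.inl ⟨hi, hj⟩
    · exact Or.inr ⟨hi, hj⟩
    · exact absurd (hi.trans hj.symm) hij
  rcases hcases with ⟨rfl, rfl⟩ | ⟨rfl, rfl⟩
  · exact h01 x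
  · exact inf_conj_eq_bot_symm h01 x

end Literature.AnabelianGeometry.SemiGraphs.SemiGraphOfAnabelioids.IsProSigmaCompletion
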